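import Literature.MathematicalPhysics.KineticTheory.Hilbert6LinearizedBoltzmann
import Literature.Analysis.UnboundedOperators.LinearizedBoltzmannSymmetryProofs
import HarnessLib

/-!
# The linearised hard-sphere operator on `L²(M dv)` over `ℝ^d`: sign and symmetry (discharges)

Sibling proof file of `Hilbert6LinearizedBoltzmann.lean` (**hilbert6.S19**; D-0014: named facts
`def X : Prop` are discharged as `theorem X_holds : X`), next to `Hilbert6LinearizedBoltzmannProofs`
(the glue for the self-adjoint realisation). The statement file specialises the
prelude `Literature.Analysis.UnboundedOperators.LinearizedBoltzmann` to the velocity space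
`V d = EuclideanSpace ℝ (Fin d)`; the two facts below are the corresponding specialisations of
prelude facts discharged in
`Literature.Analysis.UnboundedOperators.LinearizedBoltzmannSymmetryProofs`
(Cercignani–Illner–Pulvirenti, *The Mathematical Theory of Dilute Gases* (1994), §7.1,
pp. 191–193: the symmetrised form (7.1.7) of `∫ g L h`, obtained from the weak formulation
(3.1.10) — exchange `v ↔ v_*` and the unit-Jacobian change of variables `(v, v_*) ↦ (v', v_*')`,
p. 35 — and its consequences (7.1.9) `(g, Lh) = (Lg, h)` and (7.1.10) `(h, Lh) ≤ 0`):

* `hardSphereLinearizedOp_nonpos_holds : hardSphereLinearizedOp_nonpos` — `⟪g, L g⟫_M ≤ 0` for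
  `g` of temperate growth (CIP (7.1.10)), from
  `Literature.Analysis.UnboundedOperators.maxwellianInner_hardSphereLinearizedOp_self_nonpos_holds`
  (`4 ⟪g, L g⟫_M = -∫∫∫ M M_* ((v - v_*)·ω)_+ (g' + g_*' - g - g_*)² ≤ 0`);
* `hardSphereLinearizedOp_symmetric_holds : hardSphereLinearizedOp_symmetric` —
  `⟪h, L g⟫_M = ⟪L h, g⟫_M` (CIP (7.1.9)), from
  `Literature.Analysis.UnboundedOperators.maxwellianInner_linearizedCollisionOp_comm_holds` applied
  to the hard-sphere kernel, which is measurable, bounded by `2 (1 + ‖(v, v_*)‖)`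
  (`|((v - v_*)·ω)_+| ≤ |v - v_*|`) and micro-reversible.

No definitions are introduced (pure proof file). Not treated here: the kernel
(`hardSphereLinearizedOp_eq_zero_iff_mem_collisionInvariants`, which is the case `E = ℝ^d` of
`Literature.Analysis.UnboundedOperators.hardSphereLinearizedOp_eq_zero_iff_holds`), the spectral
gap (Baranger–Mouhot 2005) and the self-adjoint realisation.
-/

namespace Literature.MathematicalPhysics.KineticTheory

variable {d : ℕ}

/-- **hilbert6.S19, discharge of `hardSphereLinearizedOp_nonpos`** (non-positivity of the
linearised hard-sphere collision operator on `L²(M dv)`, `M dv = stdGaussian ℝ^d`;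
Cercignani–Illner–Pulvirenti 1994 §7.1 (7.1.10), p. 192: `(h, Lh) ≤ 0`; Ellis–Pinsky 1975 §1):
for every `g : ℝ^d → ℝ` of temperate growth, `⟪g, L g⟫_M ≤ 0`. This is the case `E = ℝ^d` of
`Literature.Analysis.UnboundedOperators.maxwellianInner_hardSphereLinearizedOp_self_nonpos_holds`
(`4 ⟪g, L g⟫_M = -∫∫∫ M M_* ((v - v_*)·ω)_+ (g' + g_*' - g - g_*)² ≤ 0`, CIP (7.1.7)).
[cite: CIPDiluteGases1994, §7.1 (7.1.10) p. 192] -/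
theorem hardSphereLinearizedOp_nonpos_holds : hardSphereLinearizedOp_nonpos (d := d) :=
  fun hg =>
    Literature.Analysis.UnboundedOperators.maxwellianInner_hardSphereLinearizedOp_self_nonpos_holds hg

/-- **hilbert6.S19, discharge of `hardSphereLinearizedOp_symmetric`** (symmetry of the linearised
hard-sphere collision operator for the `L²(M dv)` pairing on functions of temperate growth;
Cercignani–Illner–Pulvirenti 1994 §7.1 (7.1.9), p. 192: `(g, Lh) = (Lg, h)`; Ellis–Pinsky 1975
§1): `⟪h, L g⟫_M = ⟪L h, g⟫_M`. This is
`Literature.Analysis.UnboundedOperators.maxwellianInner_linearizedCollisionOp_comm_holds` for the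
hard-sphere kernel on `ℝ^d`, which is measurable, bounded by `2 (1 + ‖(v, v_*)‖)` and invariant
under `(v, v_*, ω) ↦ (v', v_*', -ω)` and `(v, v_*, ω) ↦ (v_*, v, -ω)`.
[cite: CIPDiluteGases1994, §7.1 (7.1.9) p. 192] -/
theorem hardSphereLinearizedOp_symmetric_holds : hardSphereLinearizedOp_symmetric (d := d) := by
  intro g h hg hh
  -- the growth bound `|((v - v_*)·ω)_+| ≤ |v - v_*| ≤ 2 (1 + ‖(v, v_*)‖)`
  have hB : ∃ (k : ℕ) (C : ℝ), ∀ (p : V d × V d) (ω : Metric.sphere (0 : V d) 1),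
      |hardSphereKernel p ω| ≤ C * (1 + ‖p‖) ^ k := by
    refine ⟨1, 2, fun p ω => ?_⟩
    unfold hardSphereKernel
    rw [abs_of_nonneg (le_max_right _ _), pow_one]
    refine max_le ?_ (by positivity)
    calc inner ℝ (p.1 - p.2) (ω : V d) ≤ ‖p.1 - p.2‖ * ‖(ω : V d)‖ := real_inner_le_norm _ _
      _ = ‖p.1 - p.2‖ := by rw [norm_eq_of_mem_sphere ω, mul_one]
      _ ≤ ‖p.1‖ + ‖p.2‖ := norm_sub_le _ _
      _ ≤ ‖p‖ + ‖p‖ := add_le_add (norm_fst_le p) (norm_snd_le p)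
      _ ≤ 2 * (1 + ‖p‖) := by linarith [norm_nonneg p]
  exact Literature.Analysis.UnboundedOperators.maxwellianInner_linearizedCollisionOp_comm_holds
    Literature.Analysis.FluidPDE.isGradCutoffKernel_hardSphereKernel.measurable hB
    Literature.Analysis.UnboundedOperators.hardSphereKernel_collide_neg
    Literature.Analysis.UnboundedOperators.hardSphereKernel_swap_neg hg hh

end Literature.MathematicalPhysics.KineticTheory
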